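import Summits.Ventures.LatticeQCDFlow.Exactness.FlowSamplerSpectralGap
import Summits.Ventures.LatticeQCDFlow.Exactness.Phi4FlowSamplerGaussianMinorant
import Summits.Ventures.LatticeQCDFlow.Scoring.CalibrationTruths
import HarnessLib

/-!
# Autocorrelations of the flow sampler from the weight bound: `|C(n)| ≤ (1 − W⁻¹)ⁿ C(0)`, `τ_int ≤ W − ½`

HONEST FRAMING: exact (Metropolis-corrected) sampling algorithms for lattice gauge theory;
figures of merit are autocorrelation/cost numbers at stated couplings and volumes; no
continuum-physics claim.  (SCALAR calibration rung S0-A: not a gauge result.)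

Venture `LatticeQCDFlow` (cell pub-lqcd), topic `Exactness`; FANOUT row 2 (`s0-phi4`, FLOW arm).
NEW WORK of the cell, composing `Exactness/FlowSamplerSpectralGap.lean` (the `L²(w)` contraction
`∫ (Kⁿ g)² w ≤ (1 − Z/C)^{2n} ∫ g² w` on mean-zero `g` from `w ≤ C q`), row 2's lattice φ⁴ flow
sampler (`imhOpPhi4`, `Phi4IndependenceSamplerExact.lean`; `Phi4FlowSamplerGaussianMinorant.lean`
for the explicit constant) and the cell's `τ_int` vocabulary (`Scoring/CalibrationTruths.lean`:
`tauInt ρ = ½ + Σ_{t≥1} ρ t`, `tauIntWindow`).  Nothing is cited as a fact; printed counterparts,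
named only: Sokal 1989/1997 (exponential vs integrated autocorrelation time:
`τ_int ≤ ½ + Λ/(1 − Λ)`), Liu 1996 / Smith–Tierney 1996 (independence sampler: gap `1/W`).

## What is proved

* §1 (general `(X, μ)`, weight `w > 0` integrable with `Z = ∫ w`, density `q > 0` with `∫ q = 1`,
  `w ≤ C q`).  `sq_integral_mul_mul_le` — Cauchy–Schwarz `(∫ g h w)² ≤ (∫ g² w)(∫ h² w)`;
  `integral_le_of_density_le` — `Z ≤ C` (so `0 ≤ 1 − Z/C < 1`);
  **`abs_autocov_le`** — for every bounded measurable `g` with `∫ g w = 0` and every lag `n`: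
  `|∫ g (Kⁿ g) w dμ| ≤ (1 − Z/C)ⁿ ∫ g² w dμ` — the stationary autocovariance of `g` along the exact
  chain decays at least geometrically at rate `1 − W⁻¹`, `W = C/Z`;
  **`tauIntWindow_autocorr_le`**, **`tauInt_autocorr_le`** — for the normalised autocorrelation
  `ρ(n) = C(n)/C(0)`: every windowed `τ_W` and the full `τ_int = ½ + Σ_{n≥1} ρ(n)` are at most
  `C/Z − ½ = W − ½`; hence (FITNESS vocabulary) `n_eff = N/(2τ_int) ≥ N/(2W − 1)`.
* §2 (the lattice `ℝ^Λ`).  `imhOpPhi4_eq_imhOp` (`rfl`); **`phi4Flow_abs_autocov_le`** — `λ > 0`,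
  any real `J`, any positive model density with `∫ q̃ = 1` and `e^{−S} ≤ W·Z·q̃`: for every bounded
  measurable observable `f`, centred `g = f − ⟨f⟩`, and every `n`:
  `|∫ g (Kⁿ g) e^{−S}| ≤ (1 − W⁻¹)ⁿ ∫ g² e^{−S}`; **`phi4Flow_tauInt_le`** — `τ_int(f) ≤ W − ½`;
  **`phi4Flow_tauInt_le_of_gaussian_minorant`** — with a Gaussian minorant `q̃ ≥ c e^{−κΣφ²}`:
  `τ_int(f) ≤ e^{K}/(cZ) − ½`, `K = (n+1)(Σ|J|+κ)²/(4λ)`, for EVERY bounded observable.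

Reading for S0-A (no numerics implied): for the flow arm the leaderboard's ESS-per-sample is
bounded BELOW by `1/(2W − 1)` uniformly in the observable, `W = sup Z⁻¹e^{−S}/q̃` the normalised
importance-weight supremum (estimated in practice by the max-weight diagnostic of the chain); the
bound is model-free given `W`, and vacuous exactly when `W = ∞` (`Phi4FlowSamplerSticking.lean`).
NOT CLAIMED: that `τ_int` is attained, lower bounds on `τ_int`, unbounded observables, the value of
`W` for any trained network.
-/

namespace Summit.Ventures.LatticeQCDFlow.Exactness

open Real MeasureTheory Filter Finset
open Summit.Ventures.LatticeQCDFlow.Scoring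

/-! ## §1 General state space -/

section General

variable {X : Type*} [MeasurableSpace X] {μ : Measure X} {w q : X → ℝ}

/-- **Cauchy–Schwarz with the weight `w`**: `(∫ g h w)² ≤ (∫ g² w)(∫ h² w)` for bounded measurable
`g, h` and a positive integrable `w`. -/
theorem sq_integral_mul_mul_le (hw0 : ∀ t, 0 < w t) (hwm : Measurable w) (hwi : Integrable w μ)
    {g h : X → ℝ} (hgm : Measurable g) (hhm : Measurable h) {B B' : ℝ} (hgb : ∀ t, |g t| ≤ B)
    (hhb : ∀ t, |h t| ≤ B') :
    (∫ t, g t * h t * w t ∂μ) ^ 2 ≤ (∫ t, g t ^ 2 * w t ∂μ) * ∫ t, h t ^ 2 * w t ∂μ := by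
  -- bounded × integrable is integrable
  have bint : ∀ {f : X → ℝ} (_ : Measurable f) {M : ℝ} (_ : ∀ t, |f t| ≤ M),
      Integrable (fun t => f t * w t) μ := by
    intro f hfm M hfb
    refine Integrable.mono' (hwi.const_mul M) (hfm.mul hwm).aestronglyMeasurable
      (Eventually.of_forall fun t => ?_)
    rw [Real.norm_eq_abs, abs_mul, abs_of_pos (hw0 t)]
    exact mul_le_mul_of_nonneg_right (hfb t) (hw0 t).le
  have hg2b : ∀ t, |g t ^ 2| ≤ B ^ 2 := fun t => by
    rw [abs_of_nonneg (sq_nonneg _), ← sq_abs]; exact pow_le_pow_left₀ (abs_nonneg _) (hgb t) 2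
  have hh2b : ∀ t, |h t ^ 2| ≤ B' ^ 2 := fun t => by
    rw [abs_of_nonneg (sq_nonneg _), ← sq_abs]; exact pow_le_pow_left₀ (abs_nonneg _) (hhb t) 2
  have hghb : ∀ t, |g t * h t| ≤ B * B' := fun t => by
    rw [abs_mul]; exact mul_le_mul (hgb t) (hhb t) (abs_nonneg _) ((abs_nonneg _).trans (hgb t))
  have iA := bint (hgm.pow_const 2) hg2b
  have iB : Integrable (fun t => g t * h t * w t) μ := bint (hgm.mul hhm) hghb
  have iD := bint (hhm.pow_const 2) hh2b
  set A := ∫ t, g t ^ 2 * w t ∂μ with hA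
  set Bi := ∫ t, g t * h t * w t ∂μ with hBi
  set D := ∫ t, h t ^ 2 * w t ∂μ with hD
  have hA0 : 0 ≤ A := integral_nonneg fun t => mul_nonneg (sq_nonneg _) (hw0 t).le
  have hD0 : 0 ≤ D := integral_nonneg fun t => mul_nonneg (sq_nonneg _) (hw0 t).le
  rcases eq_or_lt_of_le hD0 with hDz | hDpos
  · -- `∫ h² w = 0`: `h² w = 0` a.e., hence `g h w = 0` a.e.
    have hae : (fun t => h t ^ 2 * w t) =ᵐ[μ] 0 :=
      (integral_eq_zero_iff_of_nonneg (fun t => mul_nonneg (sq_nonneg _) (hw0 t).le) iD).1 hDz.symm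
    have hB0 : Bi = 0 := by
      rw [hBi]
      refine integral_eq_zero_of_ae ?_
      filter_upwards [hae] with t ht
      have hw' : w t ≠ 0 := (hw0 t).ne'
      have : h t ^ 2 = 0 := by
        simpa [hw'] using ht
      have hh0 : h t = 0 := pow_eq_zero_iff (n := 2) (by norm_num) |>.1 this
      simp [hh0]
    rw [hB0, ← hDz]
    simp
  · have h0 : 0 ≤ ∫ t, (g t - Bi / D * h t) ^ 2 * w t ∂μ :=
      integral_nonneg fun t => mul_nonneg (sq_nonneg _) (hw0 t).le
    have e : ∫ t, (g t - Bi / D * h t) ^ 2 * w t ∂μ = A - 2 * (Bi / D) * Bi + (Bi / D) ^ 2 * D := by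
      have e1 : ∀ t, (g t - Bi / D * h t) ^ 2 * w t
          = g t ^ 2 * w t - 2 * (Bi / D) * (g t * h t * w t) + (Bi / D) ^ 2 * (h t ^ 2 * w t) := by
        intro t; ring
      simp_rw [e1]
      have i12 : Integrable (fun t => g t ^ 2 * w t - 2 * (Bi / D) * (g t * h t * w t)) μ :=
        iA.sub (iB.const_mul _)
      rw [integral_add i12 (iD.const_mul _), integral_sub iA (iB.const_mul _), integral_const_mul,
        integral_const_mul]
    rw [e] at h0
    have e2 : A - 2 * (Bi / D) * Bi + (Bi / D) ^ 2 * D = A - Bi ^ 2 / D := by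
      field_simp
      ring
    rw [e2] at h0
    have h1 : Bi ^ 2 / D ≤ A := by linarith
    rw [div_le_iff₀ hDpos] at h1
    linarith

/-- Under `w ≤ C q` with `∫ q = 1`: `Z = ∫ w ≤ C`. -/
theorem integral_le_of_density_le (hwi : Integrable w μ) (hqi : Integrable q μ)
    (hq1 : ∫ t, q t ∂μ = 1) {C : ℝ} (hC : ∀ t, w t ≤ C * q t) : ∫ t, w t ∂μ ≤ C := by
  calc ∫ t, w t ∂μ ≤ ∫ t, C * q t ∂μ := integral_mono hwi (hqi.const_mul C) hC
    _ = C := by rw [integral_const_mul, hq1, mul_one]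

/-- The constants of the rate: `0 < Z`, `0 < C`, `0 ≤ 1 − Z/C < 1`. -/
theorem rate_bounds (hw0 : ∀ t, 0 < w t) (hwi : Integrable w μ) (hq0 : ∀ t, 0 < q t)
    (hqi : Integrable q μ) (hq1 : ∫ t, q t ∂μ = 1) {C : ℝ} (hC : ∀ t, w t ≤ C * q t) :
    0 < ∫ s, w s ∂μ ∧ 0 < C ∧ 0 ≤ 1 - (∫ s, w s ∂μ) / C ∧ 1 - (∫ s, w s ∂μ) / C < 1 := by
  have hμ : μ ≠ 0 := by
    intro h
    rw [h, integral_zero_measure] at hq1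
    exact zero_ne_one hq1
  have hZ : 0 < ∫ s, w s ∂μ := by
    rw [integral_pos_iff_support_of_nonneg_ae (Eventually.of_forall fun t => (hw0 t).le) hwi]
    have : Function.support w = Set.univ := by
      ext t
      simp [(hw0 t).ne']
    rw [this]
    exact Measure.measure_univ_pos.mpr hμ
  have hCpos : 0 < C := by
    rcases isEmpty_or_nonempty X with hX | ⟨⟨t⟩⟩
    · exact absurd (Measure.eq_zero_of_isEmpty μ) hμ
    · exact pos_of_mul_pos_left ((hw0 t).trans_le (hC t)) (hq0 t).le
  refine ⟨hZ, hCpos, ?_, ?_⟩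
  · rw [sub_nonneg, div_le_one hCpos]
    exact integral_le_of_density_le hwi hqi hq1 hC
  · have : 0 < (∫ s, w s ∂μ) / C := div_pos hZ hCpos
    linarith

variable [SFinite μ]

/-- **GEOMETRIC DECAY OF THE STATIONARY AUTOCOVARIANCE.**  `w > 0` integrable, `q > 0` with
`∫ q = 1`, `w ≤ C q`; `g` bounded measurable with `∫ g w dμ = 0`.  Then for every lag `n`:
`|∫ g · (Kⁿ g) · w dμ| ≤ (1 − Z/C)ⁿ ∫ g² w dμ`. -/
theorem abs_autocov_le (hw0 : ∀ t, 0 < w t) (hwm : Measurable w) (hwi : Integrable w μ)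
    (hq0 : ∀ t, 0 < q t) (hqm : Measurable q) (hqi : Integrable q μ) (hq1 : ∫ t, q t ∂μ = 1)
    {C : ℝ} (hC : ∀ t, w t ≤ C * q t) {g : X → ℝ} (hgm : Measurable g) {B : ℝ}
    (hgb : ∀ t, |g t| ≤ B) (hg0 : ∫ t, g t * w t ∂μ = 0) (n : ℕ) :
    |∫ t, g t * ((imhOp μ w q)^[n] g) t * w t ∂μ|
      ≤ (1 - (∫ s, w s ∂μ) / C) ^ n * ∫ t, g t ^ 2 * w t ∂μ := by
  obtain ⟨hKm, hKb, -⟩ := imhOp_iterate_invariants hw0 hwm hwi hq0 hqm hqi hq1 n hgm hgb hg0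
  obtain ⟨-, -, hr0, -⟩ := rate_bounds hw0 hwi hq0 hqi hq1 hC
  set A := ∫ t, g t ^ 2 * w t ∂μ with hA
  have hA0 : 0 ≤ A := integral_nonneg fun t => mul_nonneg (sq_nonneg _) (hw0 t).le
  have hCS := sq_integral_mul_mul_le hw0 hwm hwi hgm hKm hgb hKb
  have hD := integral_imhOp_iterate_sq_le hw0 hwm hwi hq0 hqm hqi hq1 hC n hgm hgb hg0
  -- `B² ≤ A · D ≤ A · r^{2n} A = (rⁿ A)²`
  have h2 : (∫ t, g t * ((imhOp μ w q)^[n] g) t * w t ∂μ) ^ 2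
      ≤ ((1 - (∫ s, w s ∂μ) / C) ^ n * A) ^ 2 := by
    calc (∫ t, g t * ((imhOp μ w q)^[n] g) t * w t ∂μ) ^ 2
        ≤ A * ∫ t, ((imhOp μ w q)^[n] g) t ^ 2 * w t ∂μ := hCS
      _ ≤ A * (((1 - (∫ s, w s ∂μ) / C) ^ 2) ^ n * A) := mul_le_mul_of_nonneg_left hD hA0
      _ = ((1 - (∫ s, w s ∂μ) / C) ^ n * A) ^ 2 := by
          rw [← pow_mul, mul_comm 2 n, pow_mul]
          ring
  exact abs_le_of_sq_le_sq h2 (mul_nonneg (pow_nonneg hr0 n) hA0)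

/-- The normalised autocorrelation is bounded by the geometric sequence: `|ρ(n)| ≤ (1 − Z/C)ⁿ`
(`ρ(n) = C(n)/C(0)`; Lean's `x/0 = 0` makes the degenerate case `C(0) = 0` trivial). -/
theorem abs_autocorr_le (hw0 : ∀ t, 0 < w t) (hwm : Measurable w) (hwi : Integrable w μ)
    (hq0 : ∀ t, 0 < q t) (hqm : Measurable q) (hqi : Integrable q μ) (hq1 : ∫ t, q t ∂μ = 1)
    {C : ℝ} (hC : ∀ t, w t ≤ C * q t) {g : X → ℝ} (hgm : Measurable g) {B : ℝ}
    (hgb : ∀ t, |g t| ≤ B) (hg0 : ∫ t, g t * w t ∂μ = 0) (n : ℕ) :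
    |(∫ t, g t * ((imhOp μ w q)^[n] g) t * w t ∂μ) / ∫ t, g t ^ 2 * w t ∂μ|
      ≤ (1 - (∫ s, w s ∂μ) / C) ^ n := by
  have h := abs_autocov_le hw0 hwm hwi hq0 hqm hqi hq1 hC hgm hgb hg0 n
  have hA0 : 0 ≤ ∫ t, g t ^ 2 * w t ∂μ := integral_nonneg fun t => mul_nonneg (sq_nonneg _) (hw0 t).le
  rcases eq_or_lt_of_le hA0 with hAz | hApos
  · rw [← hAz, div_zero, abs_zero]
    obtain ⟨-, -, hr0, -⟩ := rate_bounds hw0 hwi hq0 hqi hq1 hC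
    exact pow_nonneg hr0 n
  · rw [abs_div, abs_of_pos hApos, div_le_iff₀ hApos]
    exact h

/-- **`τ_int ≤ W − ½` (windowed).**  With `ρ(n) = C(n)/C(0)` the normalised autocorrelation of a
bounded mean-zero observable along the stationary chain, every windowed integrated
autocorrelation time satisfies `τ_{W'} = ½ + Σ_{n=1}^{W'} ρ(n) ≤ C/Z − ½`. -/
theorem tauIntWindow_autocorr_le (hw0 : ∀ t, 0 < w t) (hwm : Measurable w) (hwi : Integrable w μ)
    (hq0 : ∀ t, 0 < q t) (hqm : Measurable q) (hqi : Integrable q μ) (hq1 : ∫ t, q t ∂μ = 1)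
    {C : ℝ} (hC : ∀ t, w t ≤ C * q t) {g : X → ℝ} (hgm : Measurable g) {B : ℝ}
    (hgb : ∀ t, |g t| ≤ B) (hg0 : ∫ t, g t * w t ∂μ = 0) (W' : ℕ) :
    tauIntWindow (fun n => (∫ t, g t * ((imhOp μ w q)^[n] g) t * w t ∂μ)
        / ∫ t, g t ^ 2 * w t ∂μ) W'
      ≤ C / (∫ s, w s ∂μ) - 1 / 2 := by
  obtain ⟨hZ, hCpos, hr0, hr1⟩ := rate_bounds hw0 hwi hq0 hqi hq1 hC
  set r := 1 - (∫ s, w s ∂μ) / C with hr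
  have hrabs : |r| < 1 := by rw [abs_of_nonneg hr0]; exact hr1
  have hgeo := hasSum_geometric_succ hrabs
  have hsum : ∑ t ∈ Finset.range W', (fun n => (∫ s, g s * ((imhOp μ w q)^[n] g) s * w s ∂μ)
      / ∫ s, g s ^ 2 * w s ∂μ) (t + 1) ≤ r / (1 - r) := by
    calc ∑ t ∈ Finset.range W', (fun n => (∫ s, g s * ((imhOp μ w q)^[n] g) s * w s ∂μ)
          / ∫ s, g s ^ 2 * w s ∂μ) (t + 1)
        ≤ ∑ t ∈ Finset.range W', r ^ (t + 1) :=
          Finset.sum_le_sum fun t _ =>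
            (le_abs_self _).trans (abs_autocorr_le hw0 hwm hwi hq0 hqm hqi hq1 hC hgm hgb hg0 (t + 1))
      _ ≤ r / (1 - r) := sum_le_hasSum _ (fun t _ => pow_nonneg hr0 _) hgeo
  have e : r / (1 - r) = C / (∫ s, w s ∂μ) - 1 := by
    have hZne : (∫ s, w s ∂μ) ≠ 0 := hZ.ne'
    have hCne : C ≠ 0 := hCpos.ne'
    have h1r : 1 - r ≠ 0 := by linarith
    rw [div_eq_iff h1r, hr]
    field_simp
    ring
  unfold tauIntWindow
  linarith

/-- **`τ_int ≤ W − ½` (full sum).**  The autocorrelation series of a bounded mean-zero observable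
along the exact stationary chain is absolutely summable and
`τ_int = ½ + Σ_{n≥1} ρ(n) ≤ C/Z − ½ = W − ½`, `W = C/Z`; in the cell's vocabulary
`n_eff = N/(2 τ_int) ≥ N/(2W − 1)`. -/
theorem tauInt_autocorr_le (hw0 : ∀ t, 0 < w t) (hwm : Measurable w) (hwi : Integrable w μ)
    (hq0 : ∀ t, 0 < q t) (hqm : Measurable q) (hqi : Integrable q μ) (hq1 : ∫ t, q t ∂μ = 1)
    {C : ℝ} (hC : ∀ t, w t ≤ C * q t) {g : X → ℝ} (hgm : Measurable g) {B : ℝ}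
    (hgb : ∀ t, |g t| ≤ B) (hg0 : ∫ t, g t * w t ∂μ = 0) :
    tauInt (fun n => (∫ t, g t * ((imhOp μ w q)^[n] g) t * w t ∂μ) / ∫ t, g t ^ 2 * w t ∂μ)
      ≤ C / (∫ s, w s ∂μ) - 1 / 2 := by
  obtain ⟨hZ, hCpos, hr0, hr1⟩ := rate_bounds hw0 hwi hq0 hqi hq1 hC
  set r := 1 - (∫ s, w s ∂μ) / C with hr
  set ρ : ℕ → ℝ := fun n => (∫ t, g t * ((imhOp μ w q)^[n] g) t * w t ∂μ)
    / ∫ t, g t ^ 2 * w t ∂μ with hρ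
  have hrabs : |r| < 1 := by rw [abs_of_nonneg hr0]; exact hr1
  have hgeo := hasSum_geometric_succ hrabs
  have hbound : ∀ t, |ρ (t + 1)| ≤ r ^ (t + 1) := fun t =>
    abs_autocorr_le hw0 hwm hwi hq0 hqm hqi hq1 hC hgm hgb hg0 (t + 1)
  have hsumm : Summable fun t => ρ (t + 1) :=
    Summable.of_norm_bounded hgeo.summable fun t => by rw [Real.norm_eq_abs]; exact hbound t
  have hle : ∑' t, ρ (t + 1) ≤ ∑' t, r ^ (t + 1) :=
    hsumm.tsum_le_tsum (fun t => (le_abs_self _).trans (hbound t)) hgeo.summable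
  rw [hgeo.tsum_eq] at hle
  have e : r / (1 - r) = C / (∫ s, w s ∂μ) - 1 := by
    have hZne : (∫ s, w s ∂μ) ≠ 0 := hZ.ne'
    have hCne : C ≠ 0 := hCpos.ne'
    have h1r : 1 - r ≠ 0 := by linarith
    rw [div_eq_iff h1r, hr]
    field_simp
    ring
  unfold tauInt
  linarith

end General

/-! ## §2 The lattice: autocorrelations of the φ⁴ flow sampler -/

section Lattice

variable {n : ℕ}

/-- Row 2's lattice operator IS the general one: `imhOpPhi4 J λ q̃ = imhOp volume (e^{−S}) q̃`. -/
theorem imhOpPhi4_eq_imhOp (J : Fin (n + 1) → Fin (n + 1) → ℝ) (lam : ℝ)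
    (q : (Fin (n + 1) → ℝ) → ℝ) : imhOpPhi4 J lam q = imhOp volume (gibbsWeight J lam) q := by
  funext f φ
  rfl

/-- The centred observable `f − ⟨f⟩` of a bounded measurable `f` is measurable, bounded and has
mean zero under `e^{−S} dφ` (`λ > 0`). -/
theorem centred_observable {lam : ℝ} (hlam : 0 < lam) (J : Fin (n + 1) → Fin (n + 1) → ℝ)
    {f : (Fin (n + 1) → ℝ) → ℝ} (hfm : Measurable f) {B : ℝ} (hfb : ∀ φ, |f φ| ≤ B) :
    Measurable (fun ψ => f ψ - gibbsExpect J lam f)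
      ∧ (∀ ψ, |f ψ - gibbsExpect J lam f| ≤ B + |gibbsExpect J lam f|)
      ∧ ∫ φ, (f φ - gibbsExpect J lam f) * gibbsWeight J lam φ = 0 := by
  have hZ := gibbsZ_pos hlam J
  have hwi := integrable_gibbsWeight hlam J
  refine ⟨hfm.sub measurable_const, fun ψ => ?_, ?_⟩
  · have h := abs_sub (f ψ) (gibbsExpect J lam f)
    linarith [hfb ψ]
  · have hfw : Integrable (fun φ => f φ * gibbsWeight J lam φ) := by
      refine Integrable.mono' (hwi.const_mul B)
        (hfm.mul (continuous_gibbsWeight J lam).measurable).aestronglyMeasurable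
        (Eventually.of_forall fun φ => ?_)
      rw [Real.norm_eq_abs, abs_mul, abs_of_pos (gibbsWeight_pos J lam φ)]
      exact mul_le_mul_of_nonneg_right (hfb φ) (gibbsWeight_pos J lam φ).le
    have e : ∀ φ, (f φ - gibbsExpect J lam f) * gibbsWeight J lam φ
        = f φ * gibbsWeight J lam φ - gibbsExpect J lam f * gibbsWeight J lam φ := fun φ => by ring
    simp_rw [e]
    rw [integral_sub hfw (hwi.const_mul _), integral_const_mul]
    have hZne : (∫ φ, gibbsWeight J lam φ) ≠ 0 := by unfold gibbsZ at hZ; exact hZ.ne'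
    unfold gibbsExpect gibbsZ
    rw [div_mul_cancel₀ _ hZne, sub_self]

/-- **AUTOCOVARIANCE DECAY OF THE φ⁴ FLOW SAMPLER.**  `λ > 0`, any real `J`, positive measurable
model density with `∫ q̃ = 1` and weight bound `e^{−S} ≤ W·Z·q̃`; `f` bounded measurable,
`g = f − ⟨f⟩` its centring.  Then for every lag `n`:
`|∫ g (Kⁿ g) e^{−S} dφ| ≤ (1 − W⁻¹)ⁿ ∫ g² e^{−S} dφ`. -/
theorem phi4Flow_abs_autocov_le {lam : ℝ} (hlam : 0 < lam) (J : Fin (n + 1) → Fin (n + 1) → ℝ)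
    {q : (Fin (n + 1) → ℝ) → ℝ} (hq0 : ∀ φ, 0 < q φ) (hqm : Measurable q) (hqi : Integrable q)
    (hq1 : ∫ φ, q φ = 1) {W : ℝ} (hW : ∀ φ, gibbsWeight J lam φ ≤ W * gibbsZ J lam * q φ)
    {f : (Fin (n + 1) → ℝ) → ℝ} (hfm : Measurable f) {B : ℝ} (hfb : ∀ φ, |f φ| ≤ B) (k : ℕ) :
    |∫ φ, (f φ - gibbsExpect J lam f) * ((imhOpPhi4 J lam q)^[k] (fun ψ => f ψ - gibbsExpect J lam f)) φ
        * gibbsWeight J lam φ|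
      ≤ (1 - W⁻¹) ^ k * ∫ φ, (f φ - gibbsExpect J lam f) ^ 2 * gibbsWeight J lam φ := by
  have hZ := gibbsZ_pos hlam J
  have hwi := integrable_gibbsWeight hlam J
  obtain ⟨hgm, hgb, hg0⟩ := centred_observable hlam J hfm hfb
  have hC : ∀ φ, gibbsWeight J lam φ ≤ (W * gibbsZ J lam) * q φ := fun φ => by
    rw [mul_assoc] at *
    calc gibbsWeight J lam φ ≤ W * gibbsZ J lam * q φ := hW φ
      _ = W * (gibbsZ J lam * q φ) := by ring
  have h := abs_autocov_le (μ := volume) (fun φ => gibbsWeight_pos J lam φ)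
    (continuous_gibbsWeight J lam).measurable hwi hq0 hqm hqi hq1 hC hgm hgb hg0 k
  rw [imhOpPhi4_eq_imhOp]
  have e : 1 - (∫ s, gibbsWeight J lam s) / (W * gibbsZ J lam) = 1 - W⁻¹ := by
    unfold gibbsZ
    have hZ' : (∫ s, gibbsWeight J lam s) ≠ 0 := by unfold gibbsZ at hZ; exact hZ.ne'
    field_simp
  rw [e] at h
  exact h

/-- **`τ_int ≤ W − ½` FOR EVERY BOUNDED OBSERVABLE OF THE φ⁴ FLOW SAMPLER** (weight bound
`e^{−S} ≤ W·Z·q̃`): with `ρ(n) = C(n)/C(0)` the normalised stationary autocorrelation of `f`,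
`τ_int = ½ + Σ_{n≥1} ρ(n) ≤ W − ½`, i.e. ESS per sample `≥ 1/(2W − 1)`. -/
theorem phi4Flow_tauInt_le {lam : ℝ} (hlam : 0 < lam) (J : Fin (n + 1) → Fin (n + 1) → ℝ)
    {q : (Fin (n + 1) → ℝ) → ℝ} (hq0 : ∀ φ, 0 < q φ) (hqm : Measurable q) (hqi : Integrable q)
    (hq1 : ∫ φ, q φ = 1) {W : ℝ} (hW : ∀ φ, gibbsWeight J lam φ ≤ W * gibbsZ J lam * q φ)
    {f : (Fin (n + 1) → ℝ) → ℝ} (hfm : Measurable f) {B : ℝ} (hfb : ∀ φ, |f φ| ≤ B) :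
    tauInt (fun k => (∫ φ, (f φ - gibbsExpect J lam f)
        * ((imhOpPhi4 J lam q)^[k] (fun ψ => f ψ - gibbsExpect J lam f)) φ * gibbsWeight J lam φ)
        / ∫ φ, (f φ - gibbsExpect J lam f) ^ 2 * gibbsWeight J lam φ)
      ≤ W - 1 / 2 := by
  have hZ := gibbsZ_pos hlam J
  have hwi := integrable_gibbsWeight hlam J
  obtain ⟨hgm, hgb, hg0⟩ := centred_observable hlam J hfm hfb
  have hC : ∀ φ, gibbsWeight J lam φ ≤ (W * gibbsZ J lam) * q φ := fun φ => by
    calc gibbsWeight J lam φ ≤ W * gibbsZ J lam * q φ := hW φ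
      _ = W * gibbsZ J lam * q φ := rfl
  have h := tauInt_autocorr_le (μ := volume) (fun φ => gibbsWeight_pos J lam φ)
    (continuous_gibbsWeight J lam).measurable hwi hq0 hqm hqi hq1 hC hgm hgb hg0
  rw [imhOpPhi4_eq_imhOp]
  have e : W * gibbsZ J lam / (∫ s, gibbsWeight J lam s) = W := by
    unfold gibbsZ
    have hZ' : (∫ s, gibbsWeight J lam s) ≠ 0 := by unfold gibbsZ at hZ; exact hZ.ne'
    field_simp
  rw [e] at h
  exact h

/-- **`τ_int ≤ e^{K}/(cZ) − ½` FROM A GAUSSIAN MINORANT OF THE FLOW.**  `λ > 0`, any real `J`,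
positive measurable model density with `∫ q̃ = 1` and `q̃ ≥ c e^{−κΣφ²}` (`c > 0`): for EVERY bounded
measurable observable the integrated autocorrelation time of the exact flow sampler is at most
`e^{K}/(c Z) − ½`, `K = (n+1)(Σ|J|+κ)²/(4λ)`, `Z = ∫ e^{−S}`. -/
theorem phi4Flow_tauInt_le_of_gaussian_minorant {lam : ℝ} (hlam : 0 < lam)
    (J : Fin (n + 1) → Fin (n + 1) → ℝ) {q : (Fin (n + 1) → ℝ) → ℝ} (hq0 : ∀ φ, 0 < q φ)
    (hqm : Measurable q) (hqi : Integrable q) (hq1 : ∫ φ, q φ = 1) {c κ : ℝ} (hc : 0 < c)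
    (hqc : ∀ φ, c * Real.exp (-(κ * ∑ w, φ w ^ 2)) ≤ q φ)
    {f : (Fin (n + 1) → ℝ) → ℝ} (hfm : Measurable f) {B : ℝ} (hfb : ∀ φ, |f φ| ≤ B) :
    tauInt (fun k => (∫ φ, (f φ - gibbsExpect J lam f)
        * ((imhOpPhi4 J lam q)^[k] (fun ψ => f ψ - gibbsExpect J lam f)) φ * gibbsWeight J lam φ)
        / ∫ φ, (f φ - gibbsExpect J lam f) ^ 2 * gibbsWeight J lam φ)
      ≤ Real.exp ((n + 1) * (((∑ y, ∑ z, |J y z|) + κ) ^ 2 / (4 * lam))) / (c * gibbsZ J lam)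
        - 1 / 2 := by
  have hZ := gibbsZ_pos hlam J
  set K := (n + 1 : ℝ) * (((∑ y, ∑ z, |J y z|) + κ) ^ 2 / (4 * lam)) with hK
  have hW : ∀ φ, gibbsWeight J lam φ ≤ Real.exp K / (c * gibbsZ J lam) * gibbsZ J lam * q φ := by
    intro φ
    calc gibbsWeight J lam φ ≤ Real.exp K / c * q φ := gibbsWeight_le_of_gaussian_minorant hlam J hc hqc φ
      _ = Real.exp K / (c * gibbsZ J lam) * gibbsZ J lam * q φ := by field_simp
  exact phi4Flow_tauInt_le hlam J hq0 hqm hqi hq1 hW hfm hfb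

end Lattice

end Summit.Ventures.LatticeQCDFlow.Exactness
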